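import Mathlib
import HarnessLib.Audit
import Summits.PneNP.PneNP.Theorems.ClusUniversalCertificateCoordDefs

/-!
# Route ClusUniversalCertificate — TREE-COUNT on the crux `UniversalCertAll` (stmt-PneNP-19683): `TCMId`, `TCMmin`, `TIIsum`, `HALLmin`
(rung F-N1, cell pnp-ideate, planner p1 g12 ROUND-12 "TREE-COUNT programme"; landing of the planner's sorry-free file
`HOME/pnp-ideate-p1/lines/treecount-TCS-UNREGISTERED.lean` sha16 `007948cc58786841`, referee SCOREs 139 / 142 PASS, ROUND-12.md §2 / §7 T1 —
statements byte-faithful, first half: lines 28–342; the SET version / local saturation / TII-F follow in `ClusUniversalCertificateTreeCountSet`)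

`tcEx M n blk Y k C` = excess demand exported upward by the prefix class `C` when `k` blocks (indices `n-k … n-1`)
remain to be queried: leaves carry `e⁺(y) = (dim_Y y − Σ_j (bsize j − 1))⁺` (dimension taken in the WHOLE set `Y`),
and a class queried at block `j = n-k` exports `Σ_v ( tcEx (k-1) (C ∩ {block j = v}) − Z_j(C) )⁺`
(every value-child may sink up to `Z_j(C) = #{t ∈ C : t_j = 0}` units).  `TCMId M`: the root exports nothing.
`tcMin` / `TCMmin M`: the same recursion with the translation-invariant MIN capacities `μ = min_v #{t ∈ class : t_j = v}`;
`TIIsum M`: the `L = Y` case of the transportation dual (`Σ e⁺ ≤` total min-capacity); `HALLmin M`: the Hall form for every sub-family `L`.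

PROVED HERE (no sorry): `tcmMin_gives_tii : TCMmin M → TIIsum M`, `tcmMin_gives_tcm : TCMmin M → TCMId M`,
`tcm_gives_uc : TCMId M → UCMixDim M` (`ClusUniversalCertificateCoordDefs.UCMixDim`, the hypothesis of the landed
`ClusUniversalCertificateCoordTransfer.stub_transfer`; the compositions with the route decl `UniversalCertAll` are kept OUT of this
route-independent file, in `ClusUniversalCertificateTreeCountCloses`).  OPEN: `TCMmin M`, `TCMId M`, `TIIsum M`, `HALLmin M` themselves
(`@[conjecture]`: conjectural sufficient conditions for the crux; census and evidence in the planner's ROUND-12.md §3 — every finished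
enumeration clean).
Aside (not stated, to keep the file sorry-free): `HALLmin M ↔ TCMmin M` is transportation duality for the fluid problem (ROUND-12.md §2(2)).

ROUTE-INDEPENDENT (no `Theses` import) objects and arrows for an OPEN crux of route ClusUniversalCertificate.  HONEST FRAMING: FRONTIER rung
F-N1, restricted-model combinatorics — nothing here bears on `P` versus `NP`.
-/

set_option linter.dupNamespace false -- `Summit.PneNP.PneNP.…`: summit = sub-problem name (D-0017 single-conjunct layout)

namespace Summit.PneNP.PneNP.Theorems.ClusCoord

open Finset

/-- keep block `j` of `y`, zero elsewhere (block index as a natural number). -/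
def projN {M n : ℕ} (blk : Fin M → Fin n) (j : ℕ) (y : Fin M → ZMod 2) : Fin M → ZMod 2 :=
  fun i => if (blk i).val = j then y i else 0

/-- `#{t ∈ C : block j of t = 0}` (block index as a natural number). -/
noncomputable def zcountN {M n : ℕ} (blk : Fin M → Fin n) (j : ℕ) (C : Finset (Fin M → ZMod 2)) : ℕ :=
  (C.filter fun t => ∀ i, (blk i).val = j → t i = 0).card

/-- leaf demand `e⁺(y)` relative to the whole set `Y`. -/
noncomputable def eplus (M n : ℕ) (blk : Fin M → Fin n) (Y : Finset (Fin M → ZMod 2)) (y : Fin M → ZMod 2) : ℤ :=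
  max 0 (((M : ℤ) - (acodim M Y y : ℤ)) - ∑ j : Fin n, ((bsize blk j : ℤ) - 1))

/-- TREE-COUNT excess of class `C` with `k` blocks (indices `n-k, …, n-1`) still to be queried. -/
noncomputable def tcEx (M n : ℕ) (blk : Fin M → Fin n) (Y : Finset (Fin M → ZMod 2)) :
    ℕ → Finset (Fin M → ZMod 2) → ℤ
  | 0, C => ∑ y ∈ C, eplus M n blk Y y
  | k + 1, C => ∑ v ∈ C.image (projN blk (n - (k + 1))),
      max 0 (tcEx M n blk Y k (C.filter fun y => projN blk (n - (k + 1)) y = v) - (zcountN blk (n - (k + 1)) C : ℤ))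

/-- TCM for the identity block order: the root class exports no demand. -/
@[conjecture] def TCMId (M : ℕ) : Prop :=
  ∀ n : ℕ, ∀ blk : Fin M → Fin n, ∀ Y : Finset (Fin M → ZMod 2), tcEx M n blk Y n Y ≤ 0


/-- least popular value of block `j` inside the class `C`, over ALL `2^{bsize j}` values (so `0` as soon as one value is missing). -/
noncomputable def muMin {M n : ℕ} (blk : Fin M → Fin n) (j : ℕ) (C : Finset (Fin M → ZMod 2)) : ℕ :=
  sInf {s : ℕ | ∃ v : Fin M → ZMod 2, (∀ i, (blk i).val ≠ j → v i = 0) ∧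
    s = (C.filter fun y => projN blk j y = v).card}

/-- TREE-COUNT with MIN capacities (translation-invariant, no distinguished value): class `C`, `k` blocks to go. -/
noncomputable def tcMin (M n : ℕ) (blk : Fin M → Fin n) (Y : Finset (Fin M → ZMod 2)) :
    ℕ → Finset (Fin M → ZMod 2) → ℤ
  | 0, C => ∑ y ∈ C, eplus M n blk Y y
  | k + 1, C => ∑ v ∈ C.image (projN blk (n - (k + 1))),
      max 0 (tcMin M n blk Y k (C.filter fun y => projN blk (n - (k + 1)) y = v) - (muMin blk (n - (k + 1)) C : ℤ))

/-- `TCMmin M`: for every block map (identity block order) and every `Y`, the root exports nothing when each value-child of a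
class queried at block `j` may sink at most `μ = min_{v ∈ 𝔽₂^{bsize j}} #{t ∈ class : t_j = v}` units of its subtree's demand `e⁺`. -/
@[conjecture] def TCMmin (M : ℕ) : Prop :=
  ∀ n : ℕ, ∀ blk : Fin M → Fin n, ∀ Y : Finset (Fin M → ZMod 2), tcMin M n blk Y n Y ≤ 0

/-- size of block `j` (block index as a natural number). -/
def bsizeN {M n : ℕ} (blk : Fin M → Fin n) (j : ℕ) : ℕ := (univ.filter fun i => (blk i).val = j).card

/-- total min-capacity of the class tree below `C` (`k` blocks to go): a class queried at block `j` contributes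
`(#value-children) · μ(C)` — this is `2^{bsize j} · μ(C)`, since `μ(C) = 0` unless all `2^{bsize j}` values occur — plus its children's capacity. -/
noncomputable def tiiCap (M n : ℕ) (blk : Fin M → Fin n) : ℕ → Finset (Fin M → ZMod 2) → ℤ
  | 0, _ => 0
  | k + 1, C => ((C.image (projN blk (n - (k + 1)))).card : ℤ) * (muMin blk (n - (k + 1)) C : ℤ) +
      ∑ v ∈ C.image (projN blk (n - (k + 1))), tiiCap M n blk k (C.filter fun y => projN blk (n - (k + 1)) y = v)

/-- `TIIsum M` (the L = Y case of the transportation dual of `TCMmin`; m = 1 reading: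
`Σ_y dim_Y(y) ≤ 2 · Σ_{prefix classes P} min(|P0|,|P1|)`, equality on every affine subspace, every order). -/
@[conjecture] def TIIsum (M : ℕ) : Prop :=
  ∀ n : ℕ, ∀ blk : Fin M → Fin n, ∀ Y : Finset (Fin M → ZMod 2), ∑ y ∈ Y, eplus M n blk Y y ≤ tiiCap M n blk n Y

/-- Hall capacity available to the sub-family `L` inside the class tree below `C`: every child class that MEETS `L`
contributes the capacity `μ(C)` of its entering edge, plus recursively. -/
noncomputable def hallCap (M n : ℕ) (blk : Fin M → Fin n) (L : Finset (Fin M → ZMod 2)) :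
    ℕ → Finset (Fin M → ZMod 2) → ℤ
  | 0, _ => 0
  | k + 1, C => ∑ v ∈ (C ∩ L).image (projN blk (n - (k + 1))),
      ((muMin blk (n - (k + 1)) C : ℤ) + hallCap M n blk L k (C.filter fun y => projN blk (n - (k + 1)) y = v))

/-- `HALLmin M`: for every sub-family `L ⊆ Y`, the demand of `L` is at most the min-capacity of the part of the class tree it touches.
(Transportation duality: equivalent to `TCMmin M`; filed as the refuter-friendly ∀∃-free form.) -/
@[conjecture] def HALLmin (M : ℕ) : Prop :=
  ∀ n : ℕ, ∀ blk : Fin M → Fin n, ∀ Y L : Finset (Fin M → ZMod 2), L ⊆ Y →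
    ∑ y ∈ L, eplus M n blk Y y ≤ hallCap M n blk L n Y

/-- (paper: unfold the recursion, `Σ (a_v − μ)⁺ ≥ Σ a_v − q·μ`) -/
theorem tcMin_ge_demand_sub_cap (M n : ℕ) (blk : Fin M → Fin n) (Y : Finset (Fin M → ZMod 2)) :
    ∀ k C, ∑ y ∈ C, eplus M n blk Y y - tiiCap M n blk k C ≤ tcMin M n blk Y k C := by
  intro k
  induction k with
  | zero => intro C; simp [tcMin, tiiCap]
  | succ k ih =>
    intro C
    simp only [tcMin, tiiCap]
    set p := projN blk (n - (k + 1)) with hp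
    set μ : ℤ := (muMin blk (n - (k + 1)) C : ℤ) with hμ
    have hsplit : ∑ y ∈ C, eplus M n blk Y y =
        ∑ v ∈ C.image p, ∑ y ∈ C.filter (fun y => p y = v), eplus M n blk Y y :=
      (Finset.sum_fiberwise_of_maps_to (fun y hy => Finset.mem_image_of_mem p hy) _).symm
    have h3 : ∀ v ∈ C.image p,
        (∑ y ∈ C.filter (fun y => p y = v), eplus M n blk Y y
          - tiiCap M n blk k (C.filter fun y => p y = v)) - μ
        ≤ max 0 (tcMin M n blk Y k (C.filter fun y => p y = v) - μ) := by
      intro v _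
      have := ih (C.filter fun y => p y = v)
      have := le_max_right 0 (tcMin M n blk Y k (C.filter fun y => p y = v) - μ)
      linarith
    have h4 := Finset.sum_le_sum h3
    rw [Finset.sum_sub_distrib, Finset.sum_sub_distrib, Finset.sum_const, nsmul_eq_mul] at h4
    rw [hsplit]
    linarith

/-- `TCMmin ⟹ TIIsum`: the fluid recursion exports at least demand minus total min-capacity. -/
theorem tcmMin_gives_tii (M : ℕ) : TCMmin M → TIIsum M := by
  intro h n blk Y
  have h1 := tcMin_ge_demand_sub_cap M n blk Y n Y
  have h2 := h n blk Y
  linarith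

/- Aside (NOT stated as a theorem here, to keep this file sorry-free).  `HALLmin M ↔ TCMmin M` is transportation duality for the
   FLUID problem (supplies `eplus` at the points, capacity `μ` at each root-path edge, no per-(point, edge) bound): the recursion `tcMin`
   computes the fluid optimum bottom-up, and `hallCap` is its Gale–Hall dual; paper-routine (ROUND-12.md §2(2)).  The census engine's
   SET version "TCS-min" (each point uses each edge at most once; Hall dual with `min μ |L ∩ C_v|`) is formally STRONGER than `TCMmin`;
   both pass the whole ROUND-12 census; `TCMmin → TCS-min` is not claimed.  Only `TCMmin` is on the chain below. -/

/-- (paper, monotonicity of the recursion in the capacities: `μ ≤ Z_j(C)` whenever value `0` is present, and a class missing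
value `0` has `Z_j = 0 = μ`) -/
theorem muMin_le_zcountN {M n : ℕ} (blk : Fin M → Fin n) (j : ℕ) (C : Finset (Fin M → ZMod 2)) :
    muMin blk j C ≤ zcountN blk j C := by
  unfold muMin zcountN
  apply Nat.sInf_le
  refine ⟨0, fun _ _ => rfl, ?_⟩
  congr 1
  apply Finset.filter_congr
  intro t _
  constructor
  · intro h
    funext i
    by_cases hi : (blk i).val = j
    · simp [projN, hi, h i hi]
    · simp [projN, hi]
  · intro h i hi
    have := congrFun h i
    simpa [projN, hi] using this

/-- the zero-count recursion is dominated by the min-capacity recursion (`μ ≤ Z_j`). -/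
theorem tcEx_le_tcMin (M n : ℕ) (blk : Fin M → Fin n) (Y : Finset (Fin M → ZMod 2)) :
    ∀ k C, tcEx M n blk Y k C ≤ tcMin M n blk Y k C := by
  intro k
  induction k with
  | zero => intro C; simp [tcEx, tcMin]
  | succ k ih =>
    intro C
    simp only [tcEx, tcMin]
    apply Finset.sum_le_sum
    intro v _
    have h1 := ih (C.filter fun y => projN blk (n - (k + 1)) y = v)
    have h2 : (muMin blk (n - (k + 1)) C : ℤ) ≤ (zcountN blk (n - (k + 1)) C : ℤ) := by
      exact_mod_cast muMin_le_zcountN blk (n - (k + 1)) C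
    apply max_le_max le_rfl
    linarith

/-- `TCMmin ⟹ TCMId`. -/
theorem tcmMin_gives_tcm (M : ℕ) : TCMmin M → TCMId M := by
  intro h n blk Y
  exact le_trans (tcEx_le_tcMin M n blk Y n Y) (h n blk Y)

/-! ### `TCMId M → UCMixDim M` (unfold the recursion; classes at one level partition `Y`; a class has ≤ `2^{bsize j}` value-children) -/

/-- a class has at most `2^{bsize j}` value-children at block `j`. -/
theorem card_image_projN_le {M n : ℕ} (blk : Fin M → Fin n) (j : ℕ) (C : Finset (Fin M → ZMod 2)) :
    (C.image (projN blk j)).card ≤ 2 ^ bsizeN blk j := by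
  classical
  let r : (Fin M → ZMod 2) → ({i : Fin M // (blk i).val = j} → ZMod 2) := fun f i => f i.1
  have hinj : Set.InjOn r (C.image (projN blk j)) := by
    intro f hf g hg hfg
    simp only [Finset.coe_image, Set.mem_image] at hf hg
    obtain ⟨y, -, rfl⟩ := hf
    obtain ⟨z, -, rfl⟩ := hg
    funext i
    by_cases hi : (blk i).val = j
    · have := congrFun hfg ⟨i, hi⟩
      simpa [r, projN, hi] using this
    · simp [projN, hi]
  calc (C.image (projN blk j)).card
      ≤ (Finset.univ : Finset ({i : Fin M // (blk i).val = j} → ZMod 2)).card :=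
        Finset.card_le_card_of_injOn r (fun _ _ => Finset.mem_coe.mpr (Finset.mem_univ _)) hinj
    _ = 2 ^ bsizeN blk j := by
        simp [Finset.card_univ, bsizeN, ZMod.card, Fintype.card_subtype]

/-- zero-capacity of the class tree below `C` (`k` blocks to go), `(#value-children) · Z_j(C)` per class. -/
noncomputable def zcap (M n : ℕ) (blk : Fin M → Fin n) : ℕ → Finset (Fin M → ZMod 2) → ℤ
  | 0, _ => 0
  | k + 1, C => ((C.image (projN blk (n - (k + 1)))).card : ℤ) * (zcountN blk (n - (k + 1)) C : ℤ) +
      ∑ v ∈ C.image (projN blk (n - (k + 1))), zcap M n blk k (C.filter fun y => projN blk (n - (k + 1)) y = v)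

/-- unfolding the recursion: `tcEx ≥` demand minus zero-capacity (`Σ (a_v − Z)⁺ ≥ Σ a_v − q·Z`). -/
theorem tcEx_ge_demand_sub_zcap (M n : ℕ) (blk : Fin M → Fin n) (Y : Finset (Fin M → ZMod 2)) :
    ∀ k C, ∑ y ∈ C, eplus M n blk Y y - zcap M n blk k C ≤ tcEx M n blk Y k C := by
  intro k
  induction k with
  | zero => intro C; simp [tcEx, zcap]
  | succ k ih =>
    intro C
    simp only [tcEx, zcap]
    set p := projN blk (n - (k + 1)) with hp
    set Z : ℤ := (zcountN blk (n - (k + 1)) C : ℤ) with hZ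
    have hsplit : ∑ y ∈ C, eplus M n blk Y y =
        ∑ v ∈ C.image p, ∑ y ∈ C.filter (fun y => p y = v), eplus M n blk Y y :=
      (Finset.sum_fiberwise_of_maps_to (fun y hy => Finset.mem_image_of_mem p hy) _).symm
    have h3 : ∀ v ∈ C.image p,
        (∑ y ∈ C.filter (fun y => p y = v), eplus M n blk Y y
          - zcap M n blk k (C.filter fun y => p y = v)) - Z
        ≤ max 0 (tcEx M n blk Y k (C.filter fun y => p y = v) - Z) := by
      intro v _
      have := ih (C.filter fun y => p y = v)
      have := le_max_right 0 (tcEx M n blk Y k (C.filter fun y => p y = v) - Z)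
      linarith
    have h4 := Finset.sum_le_sum h3
    rw [Finset.sum_sub_distrib, Finset.sum_sub_distrib, Finset.sum_const, nsmul_eq_mul] at h4
    rw [hsplit]
    linarith

/-- the classes at one level partition their parent: zero-counts of a deeper block add up. -/
theorem zcountN_fiberwise_nat {M n : ℕ} (blk : Fin M → Fin n) (j j' : ℕ) (C : Finset (Fin M → ZMod 2)) :
    ∑ v ∈ C.image (projN blk j), zcountN blk j' (C.filter fun y => projN blk j y = v) = zcountN blk j' C := by
  unfold zcountN
  rw [Finset.card_eq_sum_card_fiberwise (s := C.filter fun t => ∀ i, (blk i).val = j' → t i = 0)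
        (t := C.image (projN blk j)) (f := projN blk j)
        (fun y hy => Finset.mem_image_of_mem _ (Finset.mem_of_mem_filter y hy))]
  apply Finset.sum_congr rfl
  intro v _
  rw [Finset.filter_filter, Finset.filter_filter]
  congr 1
  apply Finset.filter_congr
  intro t _
  tauto

/-- `zcountN_fiberwise_nat`, cast to `ℤ`. -/
theorem zcountN_fiberwise {M n : ℕ} (blk : Fin M → Fin n) (j j' : ℕ) (C : Finset (Fin M → ZMod 2)) :
    ∑ v ∈ C.image (projN blk j), (zcountN blk j' (C.filter fun y => projN blk j y = v) : ℤ) = zcountN blk j' C := by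
  exact_mod_cast zcountN_fiberwise_nat blk j j' C

/-- the zero-capacity of the class tree is at most `Σ_j 2^{bsize j} · Z_j` (children bound + partition identity, level by level). -/
theorem zcap_le (M n : ℕ) (blk : Fin M → Fin n) :
    ∀ k, k ≤ n → ∀ C : Finset (Fin M → ZMod 2), zcap M n blk k C ≤
      ∑ j ∈ (Finset.range n).filter (fun j => n - k ≤ j), (2 : ℤ) ^ bsizeN blk j * (zcountN blk j C : ℤ) := by
  intro k
  induction k with
  | zero =>
    intro _ C
    have : (Finset.range n).filter (fun j => n ≤ j) = ∅ := by
      ext j; simp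
    simp [zcap, this]
  | succ k ih =>
    intro hk C
    simp only [zcap]
    set p := projN blk (n - (k + 1)) with hp
    set j0 := n - (k + 1) with hj0
    have hS : (Finset.range n).filter (fun j => n - (k + 1) ≤ j)
        = insert j0 ((Finset.range n).filter (fun j => n - k ≤ j)) := by
      ext j; simp only [Finset.mem_filter, Finset.mem_range, Finset.mem_insert]; omega
    have hnot : j0 ∉ (Finset.range n).filter (fun j => n - k ≤ j) := by
      simp only [Finset.mem_filter, Finset.mem_range]; omega
    rw [hS, Finset.sum_insert hnot]
    -- first term: (#children) · Z ≤ 2^{bsize} · Z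
    have h1 : ((C.image p).card : ℤ) * (zcountN blk j0 C : ℤ) ≤ (2 : ℤ) ^ bsizeN blk j0 * (zcountN blk j0 C : ℤ) := by
      apply mul_le_mul_of_nonneg_right _ (by positivity)
      exact_mod_cast card_image_projN_le blk j0 C
    -- children: induction hypothesis, then swap sums and use the partition identity
    have h2 : ∑ v ∈ C.image p, zcap M n blk k (C.filter fun y => p y = v)
        ≤ ∑ v ∈ C.image p, ∑ j ∈ (Finset.range n).filter (fun j => n - k ≤ j),
            (2 : ℤ) ^ bsizeN blk j * (zcountN blk j (C.filter fun y => p y = v) : ℤ) :=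
      Finset.sum_le_sum (fun v _ => ih (by omega) _)
    rw [Finset.sum_comm] at h2
    have h3 : ∀ j ∈ (Finset.range n).filter (fun j => n - k ≤ j),
        ∑ v ∈ C.image p, (2 : ℤ) ^ bsizeN blk j * (zcountN blk j (C.filter fun y => p y = v) : ℤ)
          = (2 : ℤ) ^ bsizeN blk j * (zcountN blk j C : ℤ) := by
      intro j _
      rw [← Finset.mul_sum, zcountN_fiberwise]
    rw [Finset.sum_congr rfl h3] at h2
    linarith

/-- `bsizeN` agrees with `ClusUniversalCertificateCoordDefs.bsize` on genuine block indices. -/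
theorem bsizeN_eq_bsize {M n : ℕ} (blk : Fin M → Fin n) (j : Fin n) : bsizeN blk j.val = bsize blk j := by
  unfold bsizeN bsize
  congr 1
  apply Finset.filter_congr
  intro i _
  exact Iff.symm Fin.ext_iff

/-- `zcountN` agrees with `ClusUniversalCertificateCoordDefs.zcount` on genuine block indices. -/
theorem zcountN_eq_zcount {M n : ℕ} (blk : Fin M → Fin n) (j : Fin n) (Y : Finset (Fin M → ZMod 2)) :
    zcountN blk j.val Y = zcount blk j Y := by
  unfold zcountN zcount
  congr 1
  apply Finset.filter_congr
  intro t _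
  constructor
  · intro h i hi
    exact h i (by rw [hi])
  · intro h i hi
    exact h i (Fin.ext hi)

/-- the tree count dominates the universal certificate. -/
theorem tcm_gives_uc (M : ℕ) : TCMId M → UCMixDim M := by
  intro h n blk Y
  unfold UCMix
  have h1 := tcEx_ge_demand_sub_zcap M n blk Y n Y
  have h2 := h n blk Y
  have h3 := zcap_le M n blk n le_rfl Y
  have hfilt : (Finset.range n).filter (fun j => n - n ≤ j) = Finset.range n := by
    ext j; simp
  rw [hfilt, Finset.sum_range (fun j => (2 : ℤ) ^ bsizeN blk j * (zcountN blk j Y : ℤ))] at h3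
  simp only [bsizeN_eq_bsize, zcountN_eq_zcount] at h3
  -- e(y) ≤ e⁺(y)
  have h4 : ∑ y ∈ Y, (((M : ℤ) - (acodim M Y y : ℤ)) - ∑ j : Fin n, ((bsize blk j : ℤ) - 1))
      ≤ ∑ y ∈ Y, eplus M n blk Y y := by
    apply Finset.sum_le_sum
    intro y _
    unfold eplus
    exact le_max_right _ _
  linarith

end Summit.PneNP.PneNP.Theorems.ClusCoord
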